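import Literature.MathematicalPhysics.QuantumFieldTheory.Balaban1983to89.B13Lemma3TorusTerms
import Literature.MathematicalPhysics.QuantumFieldTheory.Balaban1983to89.B13BlockGeometryTorus

/-!
# `Balaban1983to89.B13TermSizeLaws` — T. Bałaban, *Renormalization group approach to lattice gauge field theories. II. Cluster expansions*,
Commun. Math. Phys. **116** (1988) 1–22, doi:10.1007/bf01239022 [Balaban1988RG2Cluster]:
**THE SIZE LAWS OF A (2.9)-TERM — the bonds `P` and the cubes `Y₀` of a term `(𝐃, P)` of `H(Z)` number at most `(LM)⁴`-type multiples of `|Z|`**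

statement-level skeleton of published theorems with citation tags; proofs where landed; nothing here is a claim about the
Yang–Mills mass gap

CITATION HEADER (verbatim).  p. 12 [PDF 12], (2.2)–(2.3): *"Each term in the sum over subfamilies 𝐃 has the underintegral expression localized in the
domain Y₀ = ∪_{Y∈𝐃} Y"*, *"Here the symbol |P| means the number of bonds in the set P"*; p. 14, (2.9): *"H(Z) = Σ_{Z₀ : Z′₀ ⊂ Z} H(Z, Z₀)"*; p. 18
[PDF 18], after (2.31): *"the number of such bonds is bounded by 2·4·M⁴"*-type counts per cube; p. 20 [PDF 20], before (2.37): the volume factor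
*"O(1)(LM)⁴α₅"* per cube of `Z`.  NOT PRINTED: the explicit torus bookkeeping below.

WHY THIS FILE (cell `pub-ymgap`, node N10 = [B13], seat `pub-ymgap-dag-n10-w3` g4; own-stem successor of `B13VolumeDialNumerals` (p615756) and of the junction of
record 67V (p614443)).  The dial-weighted volume binder of the N10 junction is met at a term from THREE SIZE LAWS `card Λ, card(Λ ⊕ C₀), #⋃𝐃 ≤ V·|Z|` and
four dial inequalities (`B13VolumeDialNumerals.vol_of_dials`).  For an object tower whose row-bond index of the term `t = (𝐃, P)` IS the term's bond family
`P = t.2` (the honest reading of (2.5)'s `Z₀`-bonds; `hPcard` by counting), the size laws are statements about (2.9)'s index set AS TYPED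
(`B13Lemma3TorusTerms.terms ∕ IsTerm`: every `P`-bond leaves `Y₀`, `Z₀ := Y₀ ∪ {cubes met by P} ≠ ∅`, `Z′₀ := closure(Z₀) ⊆ Z`): THIS FILE proves them
once and for all, with the explicit per-cube letter `V = d·(M·L)ᵈ` (`d = 4`; `M` the bond fineness, `L` the block size): every cube of `Z₀` lies in a block
of `Z` (§1), hence `|Z₀|, |Y₀|, #⋃𝐃 ≤ Lᵈ·|Z|` and `|P| ≤ d·(ML)ᵈ·|Z|` (§2) — print's «(LM)⁴» count of p. 20.

WHAT THIS FILE PROVES (0 `sorry`, 0 `def`; theorems only).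
§1 `tcoarse_mem_of_mem_Z0` (a cube of `Z₀` of a term of `H(Z)` lies in a block of `Z`), `tcoarse_mem_of_mem_bonds` (so does the initial cube of every `P`-bond),
   `tcoarse_mem_of_mem_Y0`.
§2 ★ `card_Z0_le` (`|Z₀| ≤ Lᵈ·|Z|`), `card_Y0_le`, ★ `card_biUnion_doms_le` (the junction's `#⋃𝐃` count `((t.1.image val).biUnion id).card ≤ Lᵈ·|Z|`),
   ★★ `card_bonds_le` (`|P| ≤ d·(M·L)ᵈ·|Z|`), and the real-cast forms `card_bonds_le_real`, `card_biUnion_doms_le_real` in the letter `V = d·(ML)ᵈ`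
   (`d·(ML)ᵈ ≥ Lᵈ`) that `vol_of_dials` ∕ «67VL» read.

HONEST SCOPE.  Finite-torus counting over cited tree definitions (`terms`, `IsTerm`, `Z0`, `Y0`, `cubesP`, `ttouch`, `tclosure`, `tcollar`, `tcoarse`,
`B13BlockGeometryTorus.card_filter_tcoarse_mem_le`); nothing of Bałaban's asserted; no object of the N10 junction is built here (the bond-indexed tower that
USES these laws is a separate storey).  Count-neutral; N10 NOT discharged; K1⁷ NOT claimed; one finite four-torus programme at fixed ε; nothing continuum ∕
ℝ⁴ ∕ OS ∕ mass-gap ∕ Clay.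
-/

namespace Literature.MathematicalPhysics.QuantumFieldTheory.Balaban1983to89.B13TermSizeLaws

open Literature.MathematicalPhysics.QuantumFieldTheory.Balaban1983to89
open Literature.MathematicalPhysics.QuantumFieldTheory.Balaban1983to89.TreeLengthTorus (TPt TDom)
open Literature.MathematicalPhysics.QuantumFieldTheory.Balaban1983to89.TreeLengthTorusTransfer (tclosure tcoarse tcollar subset_tcollar)
open Literature.MathematicalPhysics.QuantumFieldTheory.Balaban1983to89.B13Lemma3TorusData (TBond ttouch tbondEnd)
open Literature.MathematicalPhysics.QuantumFieldTheory.Balaban1983to89.B13Lemma3TorusTerms (terms mem_terms IsTerm Z0 Y0 cubesP)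
open Literature.MathematicalPhysics.QuantumFieldTheory.Balaban1983to89.B13BlockGeometryTorus (card_filter_tcoarse_mem_le)

variable {d L N' M : ℕ} [NeZero L] [NeZero N'] [NeZero M]

/-! ## §1. Every cube of `Z₀` of a term of `H(Z)` lies in a block of `Z` -/

/-- **A cube of `Z₀` lies in a block of `Z`**: `Z₀ ⊆ Z̃₀` (collar) and `Z′₀ = closure(Z₀) ⊆ Z` ((2.9): *"Z₀ : Z′₀ ⊂ Z"*).
[cite: Balaban1988RG2Cluster, (2.9) p.14] -/
theorem tcoarse_mem_of_mem_Z0 {Z : TDom d N'} {t : Finset (TDom d (L * N')) × Finset (TBond d M (L * N'))}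
    (ht : t ∈ terms L M Z) {p : TPt d (L * N')} (hp : p ∈ Z0 M t) : tcoarse L N' p ∈ Z.1 := by
  classical
  have h := (mem_terms.1 ht).2.2
  refine h (Finset.mem_image.2 ⟨p, subset_tcollar _ hp, rfl⟩)

/-- **The initial cube of a `P`-bond lies in a block of `Z`** (the bond meets the cube of its initial site, a cube of `Z₀`).
[cite: Balaban1988RG2Cluster, (2.3) p.12, (2.9) p.14] -/
theorem tcoarse_mem_of_mem_bonds {Z : TDom d N'} {t : Finset (TDom d (L * N')) × Finset (TBond d M (L * N'))}
    (ht : t ∈ terms L M Z) {b : TBond d M (L * N')} (hb : b ∈ t.2) : tcoarse L N' (tcoarse M (L * N') b.1) ∈ Z.1 := by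
  classical
  refine tcoarse_mem_of_mem_Z0 ht (Finset.mem_union_right _ (Finset.mem_biUnion.2 ⟨b, hb, ?_⟩))
  simp [ttouch]

/-- **A cube of `Y₀ = ⋃𝐃` lies in a block of `Z`** (`Y₀ ⊆ Z₀`). [cite: Balaban1988RG2Cluster, (2.2) p.12, (2.9) p.14] -/
theorem tcoarse_mem_of_mem_Y0 {Z : TDom d N'} {t : Finset (TDom d (L * N')) × Finset (TBond d M (L * N'))}
    (ht : t ∈ terms L M Z) {p : TPt d (L * N')} (hp : p ∈ Y0 t.1) : tcoarse L N' p ∈ Z.1 :=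
  tcoarse_mem_of_mem_Z0 ht (Finset.mem_union_left _ hp)

/-! ## §2. The counts: `|Z₀|, |Y₀|, #⋃𝐃 ≤ Lᵈ·|Z|` and `|P| ≤ d·(ML)ᵈ·|Z|` -/

/-- ★ **`|Z₀| ≤ Lᵈ·|Z|`**: the cubes of `Z₀` lie in the blocks of `Z`, `Lᵈ` cubes per block. [cite: Balaban1988RG2Cluster, (2.9) p.14, p.20 (before (2.37))] -/
theorem card_Z0_le {Z : TDom d N'} {t : Finset (TDom d (L * N')) × Finset (TBond d M (L * N'))} (ht : t ∈ terms L M Z) :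
    (Z0 M t).card ≤ L ^ d * Z.1.card := by
  classical
  refine le_trans (Finset.card_le_card fun p hp => ?_) (card_filter_tcoarse_mem_le L N' Z.1)
  exact Finset.mem_filter.2 ⟨Finset.mem_univ _, tcoarse_mem_of_mem_Z0 ht hp⟩

/-- **`|Y₀| ≤ Lᵈ·|Z|`**. [cite: Balaban1988RG2Cluster, (2.2) p.12, p.20 (before (2.37))] -/
theorem card_Y0_le {Z : TDom d N'} {t : Finset (TDom d (L * N')) × Finset (TBond d M (L * N'))} (ht : t ∈ terms L M Z) :
    (Y0 t.1).card ≤ L ^ d * Z.1.card := by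
  classical
  refine le_trans (Finset.card_le_card fun p hp => ?_) (card_filter_tcoarse_mem_le L N' Z.1)
  exact Finset.mem_filter.2 ⟨Finset.mem_univ _, tcoarse_mem_of_mem_Y0 ht hp⟩

/-- The junction's `#⋃𝐃` count is `|Y₀|`: `((t.1).image val).biUnion id = Y₀(t.1)`. [cite: Balaban1988RG2Cluster, (2.2) p.12, bookkeeping] -/
theorem biUnion_doms_eq_Y0 (D : Finset (TDom d (L * N'))) : (D.image Subtype.val).biUnion id = Y0 D := by
  classical
  ext p
  simp only [Finset.mem_biUnion, Finset.mem_image, id, Y0]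
  constructor
  · rintro ⟨S, ⟨Y, hY, rfl⟩, hp⟩
    exact ⟨Y, hY, hp⟩
  · rintro ⟨Y, hY, hp⟩
    exact ⟨Y.1, ⟨Y, hY, rfl⟩, hp⟩

/-- ★ **`#⋃𝐃 ≤ Lᵈ·|Z|`** in the junction's spelling `((t.1).image val).biUnion id`. [cite: Balaban1988RG2Cluster, (2.2) p.12, p.20 (before (2.37))] -/
theorem card_biUnion_doms_le {Z : TDom d N'} {t : Finset (TDom d (L * N')) × Finset (TBond d M (L * N'))} (ht : t ∈ terms L M Z) :
    (((t.1).image Subtype.val).biUnion id).card ≤ L ^ d * Z.1.card := by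
  rw [biUnion_doms_eq_Y0]
  exact card_Y0_le ht

/-- ★★ **`|P| ≤ d·(M·L)ᵈ·|Z|`**: a `P`-bond is (initial site, direction); its initial site lies in a fine cube whose block is a cube of `Z` — at most
`Mᵈ` sites per fine cube, `Lᵈ` fine cubes per block, `d` directions ((2.3): |P| = the number of bonds in P; p. 18's per-cube bond counts).
[cite: Balaban1988RG2Cluster, (2.3) p.12, p.18 (after (2.31)), p.20 (before (2.37))] -/
theorem card_bonds_le {Z : TDom d N'} {t : Finset (TDom d (L * N')) × Finset (TBond d M (L * N'))} (ht : t ∈ terms L M Z) :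
    t.2.card ≤ d * (M * L) ^ d * Z.1.card := by
  classical
  -- the fine cubes in blocks of `Z`, and the sites in those fine cubes
  set B : Finset (TPt d (L * N')) := Finset.univ.filter fun p => tcoarse L N' p ∈ Z.1 with hB
  set S : Finset (TPt d (M * (L * N'))) := Finset.univ.filter fun q => tcoarse M (L * N') q ∈ B with hS
  have hBcard : B.card ≤ L ^ d * Z.1.card := card_filter_tcoarse_mem_le L N' Z.1
  have hScard : S.card ≤ M ^ d * B.card := card_filter_tcoarse_mem_le M (L * N') B
  have hsub : t.2 ⊆ S ×ˢ (Finset.univ : Finset (Fin d)) := by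
    intro b hb
    refine Finset.mem_product.2 ⟨Finset.mem_filter.2 ⟨Finset.mem_univ _, ?_⟩, Finset.mem_univ _⟩
    exact Finset.mem_filter.2 ⟨Finset.mem_univ _, tcoarse_mem_of_mem_bonds ht hb⟩
  calc t.2.card ≤ (S ×ˢ (Finset.univ : Finset (Fin d))).card := Finset.card_le_card hsub
    _ = S.card * d := by rw [Finset.card_product, Finset.card_univ, Fintype.card_fin]
    _ ≤ (M ^ d * (L ^ d * Z.1.card)) * d := Nat.mul_le_mul_right _ (hScard.trans (Nat.mul_le_mul_left _ hBcard))
    _ = d * (M * L) ^ d * Z.1.card := by rw [mul_pow]; ring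

/-- `|P| ≤ V·|Z|` with the real letter `V = d·(M·L)ᵈ` (the shape `vol_of_dials` ∕ «67VL» read). [cite: Balaban1988RG2Cluster, (2.3) p.12, p.20 (before (2.37))] -/
theorem card_bonds_le_real {Z : TDom d N'} {t : Finset (TDom d (L * N')) × Finset (TBond d M (L * N'))} (ht : t ∈ terms L M Z) :
    (t.2.card : ℝ) ≤ ((d : ℝ) * (((M : ℝ) * L) ^ d)) * (Z.1.card : ℝ) := by
  have h := card_bonds_le ht
  have : ((t.2.card : ℕ) : ℝ) ≤ ((d * (M * L) ^ d * Z.1.card : ℕ) : ℝ) := by exact_mod_cast h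
  simpa [Nat.cast_mul, Nat.cast_pow, mul_assoc] using this

/-- `#⋃𝐃 ≤ V·|Z|` with the same letter `V = d·(M·L)ᵈ` (`Lᵈ ≤ d·(ML)ᵈ` for `d, M ≥ 1`). [cite: Balaban1988RG2Cluster, (2.2) p.12, p.20 (before (2.37))] -/
theorem card_biUnion_doms_le_real (hd : 0 < d) {Z : TDom d N'} {t : Finset (TDom d (L * N')) × Finset (TBond d M (L * N'))}
    (ht : t ∈ terms L M Z) :
    ((((t.1).image Subtype.val).biUnion id).card : ℝ) ≤ ((d : ℝ) * (((M : ℝ) * L) ^ d)) * (Z.1.card : ℝ) := by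
  have h := card_biUnion_doms_le ht
  have hM : 1 ≤ M := Nat.pos_of_ne_zero (NeZero.ne M)
  have h2 : L ^ d * Z.1.card ≤ d * (M * L) ^ d * Z.1.card := by
    refine Nat.mul_le_mul_right _ ?_
    calc L ^ d = 1 * (1 * L) ^ d := by ring
      _ ≤ d * (M * L) ^ d := Nat.mul_le_mul hd (Nat.pow_le_pow_left (Nat.mul_le_mul_right _ hM) _)
  have : (((((t.1).image Subtype.val).biUnion id).card : ℕ) : ℝ) ≤ ((d * (M * L) ^ d * Z.1.card : ℕ) : ℝ) := by
    exact_mod_cast h.trans h2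
  simpa [Nat.cast_mul, Nat.cast_pow, mul_assoc] using this

end Literature.MathematicalPhysics.QuantumFieldTheory.Balaban1983to89.B13TermSizeLaws
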